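import Literature.Analysis.FluidPDE.PassiveVectorTensorFourier
import Literature.Analysis.FunctionSpaces.TorusSobolevNorm
import HarnessLib

/-!
# K1L_D (stmt-AnomalousDissipation-27980), brick Z1′/Z6 support: explicit `|k|²` bound on the viscosity symbol and the Cauchy–Schwarz bound
# for the VISCOUS CROSS TERM of the two-problem duality (helper; `--supports … --as helper`; lead-k1l-onelevel-p1 g3)

Memo L7 / `Lines/onelevel_Z_bricks.lean` (Z1′): the pairing of a weak solution of problem 1 with an adjoint solution of problem 2 carries the viscous
cross term `Σ_k Re(−4π² ⟪û(k), T_{𝔸₁−𝔸₂}(k) ψ̂(k)⟫)`.  Its domination (for the `N → ∞` limit in Z1′) and its dissipation-weighted Cauchy–Schwarz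
form (for the §9a weights `√rate_k · √rate_k` in Z6) both come from an EXPLICIT symbol bound `‖T_𝔸(k) z‖ ≤ ‖𝔸‖₁ · |k|² · ‖z‖`,
`‖𝔸‖₁ = Σ |𝔸 i a j b|` (the tree's `exists_norm_symbT_le` hides the `k`-dependence).  THIS FILE: `norm_symbT_le_freqNormSq` and the finite-sum
cross bound `abs_sum_re_inner_symbT_le`: `|Σ_{k∈F} Re⟪X k, T_𝔸(k)(Y k)⟫| ≤ ‖𝔸‖₁ √(Σ_F |k|²‖X k‖²) √(Σ_F |k|²‖Y k‖²)`.  Pure finite-dimensional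
algebra; NOT a proof of any brick, of the crux, or of AD; rung F-D1.A0.
-/

set_option linter.dupNamespace false

noncomputable section

namespace Summit.AnomalousDissipation.AnomalousDissipation.Theorems.SolenoidalFractalHomogenisation.LagrangianStep

open Literature.Analysis Literature.Analysis.FluidPDE Literature.Analysis.FluidPDE.Torus Literature.Analysis.FunctionSpaces
open scoped InnerProductSpace

variable {d : Type*} [Fintype d]

/-- `|k_a| |k_b| ≤ |k|²`. -/
theorem abs_mul_abs_le_freqNormSq (k : d → ℤ) (a b : d) : |(k a : ℝ)| * |(k b : ℝ)| ≤ Torus.freqNormSq k := by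
  have ha : ((k a : ℝ)) ^ 2 ≤ Torus.freqNormSq k := by
    unfold Torus.freqNormSq
    exact Finset.single_le_sum (f := fun i => ((k i : ℝ)) ^ 2) (fun i _ => sq_nonneg _) (Finset.mem_univ a)
  have hb : ((k b : ℝ)) ^ 2 ≤ Torus.freqNormSq k := by
    unfold Torus.freqNormSq
    exact Finset.single_le_sum (f := fun i => ((k i : ℝ)) ^ 2) (fun i _ => sq_nonneg _) (Finset.mem_univ b)
  nlinarith [two_mul_le_add_sq (|(k a : ℝ)|) (|(k b : ℝ)|), sq_abs (k a : ℝ), sq_abs (k b : ℝ),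
    abs_nonneg (k a : ℝ), abs_nonneg (k b : ℝ)]

/-- A coordinate is bounded by the Euclidean norm. -/
theorem norm_apply_le_norm_euclidean (z : EuclideanSpace ℂ d) (i : d) : ‖z i‖ ≤ ‖z‖ := by
  rw [EuclideanSpace.norm_eq z]
  conv_lhs => rw [← Real.sqrt_sq (norm_nonneg (z i))]
  exact Real.sqrt_le_sqrt (Finset.single_le_sum (f := fun j => ‖z j‖ ^ 2) (fun j _ => sq_nonneg _) (Finset.mem_univ i))

/-- **Explicit symbol bound**: `‖T_𝔸(k) z‖ ≤ (Σ |𝔸 i a j b|) · |k|² · ‖z‖`. -/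
theorem norm_symbT_le_freqNormSq (𝔸 : Visc4 d) (k : d → ℤ) (z : EuclideanSpace ℂ d) :
    ‖symbT 𝔸 k z‖ ≤ (∑ i, ∑ a, ∑ j, ∑ b, |𝔸 i a j b|) * Torus.freqNormSq k * ‖z‖ := by
  set K : ℝ := Torus.freqNormSq k with hK
  have hK0 : 0 ≤ K := Torus.freqNormSq_nonneg k
  have hz0 : 0 ≤ ‖z‖ := norm_nonneg _
  -- coordinate bound
  set c : d → ℝ := fun j => ∑ i, ∑ a, ∑ b, |𝔸 i a j b| with hc
  have hc0 : ∀ j, 0 ≤ c j := fun j => by rw [hc]; positivity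
  have hcoord : ∀ j, ‖symbT 𝔸 k z j‖ ≤ c j * K * ‖z‖ := by
    intro j
    rw [symbT_apply]
    calc ‖∑ i, ∑ a, ∑ b, ((𝔸 i a j b * (k a : ℝ) * (k b : ℝ) : ℝ) : ℂ) * z i‖
        ≤ ∑ i, ∑ a, ∑ b, ‖((𝔸 i a j b * (k a : ℝ) * (k b : ℝ) : ℝ) : ℂ) * z i‖ := by
          refine (norm_sum_le _ _).trans (Finset.sum_le_sum fun i _ => ?_)
          refine (norm_sum_le _ _).trans (Finset.sum_le_sum fun a _ => ?_)
          exact norm_sum_le _ _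
      _ ≤ ∑ i, ∑ a, ∑ b, |𝔸 i a j b| * K * ‖z‖ := by
          refine Finset.sum_le_sum fun i _ => Finset.sum_le_sum fun a _ => Finset.sum_le_sum fun b _ => ?_
          rw [norm_mul, Complex.norm_real, Real.norm_eq_abs, abs_mul, abs_mul, mul_assoc |𝔸 i a j b|]
          have h1 : |(k a : ℝ)| * |(k b : ℝ)| ≤ K := abs_mul_abs_le_freqNormSq k a b
          have h2 : ‖z i‖ ≤ ‖z‖ := norm_apply_le_norm_euclidean z i
          have h3 : 0 ≤ |𝔸 i a j b| := abs_nonneg _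
          calc |𝔸 i a j b| * (|(k a : ℝ)| * |(k b : ℝ)|) * ‖z i‖ ≤ |𝔸 i a j b| * K * ‖z‖ := by
                gcongr
            _ = |𝔸 i a j b| * K * ‖z‖ := rfl
      _ = c j * K * ‖z‖ := by rw [hc]; simp only [Finset.sum_mul]
  -- sum of squares of coordinates
  have hsq : ‖symbT 𝔸 k z‖ ^ 2 ≤ ((∑ j, c j) * K * ‖z‖) ^ 2 := by
    rw [EuclideanSpace.norm_eq, Real.sq_sqrt (Finset.sum_nonneg fun j _ => sq_nonneg _)]
    calc ∑ j, ‖symbT 𝔸 k z j‖ ^ 2 ≤ ∑ j, (c j * K * ‖z‖) ^ 2 :=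
          Finset.sum_le_sum fun j _ => pow_le_pow_left₀ (norm_nonneg _) (hcoord j) 2
      _ = (∑ j, c j ^ 2) * (K * ‖z‖) ^ 2 := by rw [Finset.sum_mul]; exact Finset.sum_congr rfl fun j _ => by ring
      _ ≤ (∑ j, c j) ^ 2 * (K * ‖z‖) ^ 2 := by
          refine mul_le_mul_of_nonneg_right ?_ (sq_nonneg _)
          rw [sq, Finset.sum_mul]
          exact Finset.sum_le_sum fun j _ => by
            rw [sq]
            exact mul_le_mul_of_nonneg_left (Finset.single_le_sum (fun i _ => hc0 i) (Finset.mem_univ j)) (hc0 j)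
      _ = ((∑ j, c j) * K * ‖z‖) ^ 2 := by ring
  have hB0 : 0 ≤ (∑ j, c j) * K * ‖z‖ := mul_nonneg (mul_nonneg (Finset.sum_nonneg fun j _ => hc0 j) hK0) hz0
  have e : (∑ j, c j) = ∑ i, ∑ a, ∑ j, ∑ b, |𝔸 i a j b| := by
    rw [hc]; dsimp only
    rw [Finset.sum_comm]
    refine Finset.sum_congr rfl fun i _ => ?_
    rw [Finset.sum_comm]
  rw [← e]
  exact (pow_le_pow_iff_left₀ (norm_nonneg _) hB0 two_ne_zero).1 hsq

/-- **Cauchy–Schwarz for the viscous cross term (abstract symbol bound).**  If `‖Tk k z‖ ≤ A1·|k|²·‖z‖` then for coefficient families `X, Y` and a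
finite frequency set `F`: `|Σ_{k∈F} Re⟪X k, Tk k (Y k)⟫| ≤ A1 · √(Σ_F |k|²‖X k‖²) · √(Σ_F |k|²‖Y k‖²)`. -/
theorem abs_sum_re_inner_le_of_symbol_bound (Tk : (d → ℤ) → EuclideanSpace ℂ d → EuclideanSpace ℂ d) {A1 : ℝ} (hA1 : 0 ≤ A1)
    (hT : ∀ k z, ‖Tk k z‖ ≤ A1 * Torus.freqNormSq k * ‖z‖) (F : Finset (d → ℤ)) (X Y : (d → ℤ) → EuclideanSpace ℂ d) :
    |∑ k ∈ F, (⟪X k, Tk k (Y k)⟫_ℂ).re|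
      ≤ A1 * Real.sqrt (∑ k ∈ F, Torus.freqNormSq k * ‖X k‖ ^ 2) * Real.sqrt (∑ k ∈ F, Torus.freqNormSq k * ‖Y k‖ ^ 2) := by
  have hterm : ∀ k, |(⟪X k, Tk k (Y k)⟫_ℂ).re|
      ≤ A1 * ((Real.sqrt (Torus.freqNormSq k) * ‖X k‖) * (Real.sqrt (Torus.freqNormSq k) * ‖Y k‖)) := by
    intro k
    have hK0 : 0 ≤ Torus.freqNormSq k := Torus.freqNormSq_nonneg k
    have e : Real.sqrt (Torus.freqNormSq k) * Real.sqrt (Torus.freqNormSq k) = Torus.freqNormSq k := Real.mul_self_sqrt hK0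
    have h1 : |(⟪X k, Tk k (Y k)⟫_ℂ).re| ≤ ‖⟪X k, Tk k (Y k)⟫_ℂ‖ := Complex.abs_re_le_norm _
    have h2 : ‖⟪X k, Tk k (Y k)⟫_ℂ‖ ≤ ‖X k‖ * ‖Tk k (Y k)‖ := norm_inner_le_norm _ _
    have h3 : ‖X k‖ * ‖Tk k (Y k)‖ ≤ ‖X k‖ * (A1 * Torus.freqNormSq k * ‖Y k‖) :=
      mul_le_mul_of_nonneg_left (hT k (Y k)) (norm_nonneg _)
    have h4 : ‖X k‖ * (A1 * Torus.freqNormSq k * ‖Y k‖)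
        = A1 * ((Real.sqrt (Torus.freqNormSq k) * ‖X k‖) * (Real.sqrt (Torus.freqNormSq k) * ‖Y k‖)) := by
      have h5 : A1 * ((Real.sqrt (Torus.freqNormSq k) * ‖X k‖) * (Real.sqrt (Torus.freqNormSq k) * ‖Y k‖))
          = A1 * (Real.sqrt (Torus.freqNormSq k) * Real.sqrt (Torus.freqNormSq k)) * (‖X k‖ * ‖Y k‖) := by ring
      rw [h5, e]; ring
    linarith
  have hcs := Real.sum_mul_le_sqrt_mul_sqrt F (fun k => Real.sqrt (Torus.freqNormSq k) * ‖X k‖)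
    (fun k => Real.sqrt (Torus.freqNormSq k) * ‖Y k‖)
  have e1 : ∀ (Z : (d → ℤ) → EuclideanSpace ℂ d), ∑ k ∈ F, (Real.sqrt (Torus.freqNormSq k) * ‖Z k‖) ^ 2
      = ∑ k ∈ F, Torus.freqNormSq k * ‖Z k‖ ^ 2 := fun Z =>
    Finset.sum_congr rfl fun k _ => by rw [mul_pow, Real.sq_sqrt (Torus.freqNormSq_nonneg k)]
  rw [e1 X, e1 Y] at hcs
  calc |∑ k ∈ F, (⟪X k, Tk k (Y k)⟫_ℂ).re| ≤ ∑ k ∈ F, |(⟪X k, Tk k (Y k)⟫_ℂ).re| := Finset.abs_sum_le_sum_abs _ _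
    _ ≤ ∑ k ∈ F, A1 * ((Real.sqrt (Torus.freqNormSq k) * ‖X k‖) * (Real.sqrt (Torus.freqNormSq k) * ‖Y k‖)) :=
        Finset.sum_le_sum fun k _ => hterm k
    _ = A1 * ∑ k ∈ F, (Real.sqrt (Torus.freqNormSq k) * ‖X k‖) * (Real.sqrt (Torus.freqNormSq k) * ‖Y k‖) := by
        rw [Finset.mul_sum]
    _ ≤ A1 * (Real.sqrt (∑ k ∈ F, Torus.freqNormSq k * ‖X k‖ ^ 2) * Real.sqrt (∑ k ∈ F, Torus.freqNormSq k * ‖Y k‖ ^ 2)) :=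
        mul_le_mul_of_nonneg_left hcs hA1
    _ = A1 * Real.sqrt (∑ k ∈ F, Torus.freqNormSq k * ‖X k‖ ^ 2) * Real.sqrt (∑ k ∈ F, Torus.freqNormSq k * ‖Y k‖ ^ 2) := by
        rw [mul_assoc]

/-- **Cauchy–Schwarz for the viscous cross term of the two-problem duality**:
`|Σ_{k∈F} Re⟪X k, T_𝔸(k)(Y k)⟫| ≤ ‖𝔸‖₁ · √(Σ_F |k|²‖X k‖²) · √(Σ_F |k|²‖Y k‖²)`, `‖𝔸‖₁ = Σ |𝔸 i a j b|` (use with `𝔸 := 𝔸₁ − 𝔸₂`). -/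
theorem abs_sum_re_inner_symbT_le (𝔸 : Visc4 d) (F : Finset (d → ℤ)) (X Y : (d → ℤ) → EuclideanSpace ℂ d) :
    |∑ k ∈ F, (⟪X k, symbT 𝔸 k (Y k)⟫_ℂ).re|
      ≤ (∑ i, ∑ a, ∑ j, ∑ b, |𝔸 i a j b|) * Real.sqrt (∑ k ∈ F, Torus.freqNormSq k * ‖X k‖ ^ 2)
          * Real.sqrt (∑ k ∈ F, Torus.freqNormSq k * ‖Y k‖ ^ 2) :=
  abs_sum_re_inner_le_of_symbol_bound (symbT 𝔸) (by positivity) (norm_symbT_le_freqNormSq 𝔸) F X Y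

end Summit.AnomalousDissipation.AnomalousDissipation.Theorems.SolenoidalFractalHomogenisation.LagrangianStep
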